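import Summits.BirchSwinnertonDyer.Rank1Residual.X2.RankOne
import Literature.NumberTheory.EllipticCurves.Rank1Residual.GVParityTwistTransportProofs
import Literature.NumberTheory.EllipticCurves.QuadraticTwistJInvariantProofs
import Literature.NumberTheory.EllipticCurves.LFunctionSmulProofs
import Literature.NumberTheory.EllipticCurves.AnalyticRankOrderProofs
import HarnessLib

/-!
# Route `EisensteinPrimes`, crux 3 `MazurMCOnCellB` (stmt-BirchSwinnertonDyer-19033), line `twistback` v7 — ROAD (e):
# the CERTIFIED TWO-STEP EDGE `TwoStepAt p W W″` with every Heegner / Iwasawa datum discharged, as an importable module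
# (definition + bookkeeping; cell `bsd-eis`, width seat bsd-line-x2-p1-w6 g3; `--supports stmt-BirchSwinnertonDyer-19033`)

WHY THIS FILE. The registered skeleton `Cruxes/MazurMCOnCellB/Lines/twistback.lean` v7 (LEAD g13, sha256 0ee3d465…)
narrows its one open stub to `stub_upperPartnerOffSubrowNoUnitEnd`: the (∃-PARTNER) conclusion at X2b pairs `(W, p)`
carrying NO «two-step Ш-unit datum» — an admissible `K` with `r_an(E^{(d_K)}) = 1`, a minimal model `Wd` of the partner,
a second field `K″` admissible for `Wd` with `L(Wd^{(d_{K″})}, 1) ≠ 0`, a minimal model `W″` of the double twist with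
`#Ш_an(W″)` a rational `p`-unit (width seat x2-p1-w6 g2, `…TwistbackTwoStepShaUnit`, p662647). That datum is a unit end
at distance EXACTLY ONE edge. Idea-12's `anchor` line (`Cruxes/MazurMCOnCellB/Lines/anchor.lean`, workfile, NOT
registered, NOT importable) observed that the road composes along FINITE CHAINS of such edges (its `TwoStep` still
carries STEP L, co-STEP L and both Heegner data as hypotheses). This module types the edge with those data DISCHARGED —
its binders are VERBATIM the per-pair binders of x2-p1-w6 g2's two-step transfer
`…TwistbackOnePartnerAt.bsdp_of_cellB_of_twoStepBSDp` (p663790 §2) minus the named facts and minus the far end's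
`BSDp` — as a relation `TwoStepAt p` on bare Weierstrass curves (instances packed), so that chains are Mathlib's
`Relation.ReflTransGen` / `Relation.TransGen`, and proves the bookkeeping a chain argument needs: the far end of an
edge out of an X2b pair is an X2b pair again (`cellB_of_cellB_of_twoStepAt`: rank `0` from the non-vanishing reading,
class X2 by `X2.classX2_twist` twice, `¬GVPar` because `W″` is a model of the EVEN twist `E^{(d_K·d_{K″})}` unramified
at `p` — `gvPar_twist_iff_of_pos`), hence along any chain (`cellB_of_cellB_of_reflTransGen_twoStepAt`); and the v7
stub's excluded datum is literally «a unit end reachable by ONE edge»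
(`exists_transGen_twoStepAt_shaAn_unit_of_twoStepShaUnitDatum`). The companion
`Theorems/EisensteinPrimesMazurMCOnCellBTwistbackTwoStepChain.lean` carries the transfers along chains
(`BSD(E,p)` / Mazur's main conjecture / the stub's (∃-PARTNER) clause at `(W, p)` from a `BSD_p` or unit end reachable
at ANY distance), so that a later reshape may narrow the stub to «no REACHABLE unit end» with everything excluded
derived in `Theorems/`.

HONEST FRAMING. ONE definition (a `Prop`-valued RELATION with parameters `p`, `W`, `W″`; bookkeeping, [folklore]; it
asserts nothing — it is a conjunction of per-pair DATA and READINGS) + its `Iff.rfl` unfolding lemma, a constructor,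
and five bookkeeping theorems; the only named-fact hypothesis is modularity in the form
`WeierstrassCurve.hasEntireLFunction_rat` (to read `r_an = 0` off `L(W″,1) ≠ 0`). No instance, no notation, no `sorry`.
Nothing about any `L`-value, Selmer group, main conjecture or BSD is asserted; no summit statement / Mazur MC / BSD is
proved for any curve; closes no registered stub; 0 cells / labels / stubs / tiers move. Whether every X2b pair REACHES a
unit end is idea-12's OPEN supply statement (`UnitAnchorSupply`; census `Cruxes/MazurMCOnCellB/ANCHOR-CENSUS-g8.md`:
46/46 computed X2b classes at `p = 3`, `N ≤ 900`, reach one in ONE edge) and is NOT claimed here.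

## The objects

* `TwoStepAt p W W″` — «`W″` is the far end of a certified Heegner two-step out of `W` at `p`»: `W`, `W″` elliptic and
  globally minimal (packed); an imaginary quadratic `K`, Heegner for `N_W` and for `p`, `d_K` odd `< −4`, with
  `ord_{s=1} L(E^{(d_K)}, s) = 1`; a globally minimal model `Wd` of `E^{(d_K)}`; an imaginary quadratic `K″`, `d_{K″}` odd
  `< −4`, Heegner for `N_{Wd}` and for `p`, with `L(Wd^{(d_{K″})}, 1) ≠ 0`; and `W″` a model of `Wd^{(d_{K″})}`.
* `twoStepAt_iff` (unfolding), `twoStepAt_intro` (constructor from ambient instances),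
  `exists_smul_eq_quadraticTwist_mul` (a model of a twist of a model of a twist is a model of the product twist:
  `quadraticTwist_smul`, `quadraticTwist_quadraticTwist`), `TwoStepAt.exists_smul_eq_quadraticTwist_pos` (the far end is a
  model of `E^{(D)}` with `D = d_K d_{K″} > 0`, `p ∤ D`: `not_dvd_discr_of_split`), `cellB_of_cellB_of_twoStepAt`,
  `cellB_of_cellB_of_reflTransGen_twoStepAt`, `exists_transGen_twoStepAt_shaAn_unit_of_twoStepShaUnitDatum`.

References: idea-12 `Cruxes/MazurMCOnCellB/Lines/anchor.lean` / `Ideas/anchor.md` rev 1.3 (the graph and the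
reachability form; source of the idea); LEAD g7 `…TwistbackUnitLever` §4 (p627870); x2-p1-w6 g2 p662647 / p663790 /
p664945; LEAD g13 `Lines/twistback-lead-verdict-g13.md` §7; R. Greenberg, V. Vatsal, Invent. Math. 142 (2000), remark
after Thm. (1.3) (even twists prime to `p` preserve the hypotheses) [GreenbergVatsal2000]; C. Wuthrich, J. London
Math. Soc. 90 (2014) Prop. 21 [Wuthrich2014]; J. H. Silverman, AEC X.2, X.5 (twists compose) [Silverman2009].
-/

set_option autoImplicit false

-- `Summit.BirchSwinnertonDyer.BirchSwinnertonDyer.…`: the summit and its single sub-problem share a name.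
set_option linter.dupNamespace false

noncomputable section

open scoped Classical

open WeierstrassCurve NumberField
  Literature.NumberTheory.EllipticCurves
  Literature.NumberTheory.QuadraticFields
  Literature.NumberTheory.EllipticCurves.Rank1Residual
  Literature.NumberTheory.EllipticCurves.Rank1Residual.Typed
  Summit.BirchSwinnertonDyer.Rank1Residual

namespace Summit.BirchSwinnertonDyer.BirchSwinnertonDyer.Theorems.EisensteinPrimesMazurMCOnCellBTwistbackTwoStepDefs

/-! ## §1. The edge -/

/-- **The certified two-step edge of road (e), data discharged.** `TwoStepAt p W W″` says: `W` and `W″` are (globally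
minimal models of) elliptic curves over `ℚ` — the instances are PACKED so that this is a relation on bare Weierstrass
curves and chains are `Relation.ReflTransGen (TwoStepAt p)` —, and there are: an imaginary quadratic field `K`
satisfying the Heegner hypothesis for `N_W` and for `p` (`p` split), with `d_K` odd `< −4` and
`ord_{s=1} L(E^{(d_K)}, s) = 1`; a globally minimal model `Wd` of the partner `E^{(d_K)}`; a second imaginary quadratic
field `K″`, `d_{K″}` odd `< −4`, Heegner for `N_{Wd}` and for `p`, with `L(Wd^{(d_{K″})}, 1) ≠ 0`; and a change of
variables exhibiting `W″` as a model of `Wd^{(d_{K″})}`. VERBATIM the per-pair binders of x2-p1-w6 g2's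
`…TwistbackOnePartnerAt.bsdp_of_cellB_of_twoStepBSDp` (p663790) other than the named facts, `X2.CellB W p` and
`BSDp W″ p`; VERBATIM the inner shape of the registered v7 stub's excluded datum without its last clause (the unit). A
bookkeeping predicate: nothing is asserted; whether such edges EXIST out of a given pair is a reading / supply question
(Bump–Friedberg–Hoffstein for `K`; Waldspurger-type non-vanishing for `K″`), not settled here. [folklore] -/
@[folklore] def TwoStepAt (p : ℕ) (W W'' : WeierstrassCurve ℚ) : Prop :=
  ∃ (_ : W.IsElliptic) (_ : W.IsGloballyMinimal) (_ : W''.IsElliptic) (_ : W''.IsGloballyMinimal)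
    (K : Type) (_ : Field K) (_ : NumberField K), IsImaginaryQuadratic K ∧
    SatisfiesHeegnerHypothesis (W.conductorNorm ℤ) K ∧ SatisfiesHeegnerHypothesis p K ∧
    Odd (NumberField.discr K) ∧ NumberField.discr K < -4 ∧
    (W.quadraticTwist (NumberField.discr K : ℚ)).analyticRank = 1 ∧
    ∃ (Wd : WeierstrassCurve ℚ) (_ : Wd.IsElliptic) (_ : Wd.IsGloballyMinimal),
      (∃ C : VariableChange ℚ, C • Wd = W.quadraticTwist (NumberField.discr K : ℚ)) ∧
      ∃ (K'' : Type) (_ : Field K'') (_ : NumberField K''), IsImaginaryQuadratic K'' ∧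
        Odd (NumberField.discr K'') ∧ NumberField.discr K'' < -4 ∧
        SatisfiesHeegnerHypothesis (Wd.conductorNorm ℤ) K'' ∧ SatisfiesHeegnerHypothesis p K'' ∧
        (Wd.quadraticTwist (NumberField.discr K'' : ℚ)).entireLFunction 1 ≠ 0 ∧
        ∃ C : VariableChange ℚ, C • W'' = Wd.quadraticTwist (NumberField.discr K'' : ℚ)

/-- Unfolding lemma: `TwoStepAt p W W″` is by definition the displayed existential (for `rw` / `simp only` in
consumers that state the datum in expanded form, e.g. a skeleton stub). [folklore] -/
theorem twoStepAt_iff (p : ℕ) (W W'' : WeierstrassCurve ℚ) :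
    TwoStepAt p W W'' ↔
    ∃ (_ : W.IsElliptic) (_ : W.IsGloballyMinimal) (_ : W''.IsElliptic) (_ : W''.IsGloballyMinimal)
      (K : Type) (_ : Field K) (_ : NumberField K), IsImaginaryQuadratic K ∧
      SatisfiesHeegnerHypothesis (W.conductorNorm ℤ) K ∧ SatisfiesHeegnerHypothesis p K ∧
      Odd (NumberField.discr K) ∧ NumberField.discr K < -4 ∧
      (W.quadraticTwist (NumberField.discr K : ℚ)).analyticRank = 1 ∧
      ∃ (Wd : WeierstrassCurve ℚ) (_ : Wd.IsElliptic) (_ : Wd.IsGloballyMinimal),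
        (∃ C : VariableChange ℚ, C • Wd = W.quadraticTwist (NumberField.discr K : ℚ)) ∧
        ∃ (K'' : Type) (_ : Field K'') (_ : NumberField K''), IsImaginaryQuadratic K'' ∧
          Odd (NumberField.discr K'') ∧ NumberField.discr K'' < -4 ∧
          SatisfiesHeegnerHypothesis (Wd.conductorNorm ℤ) K'' ∧ SatisfiesHeegnerHypothesis p K'' ∧
          (Wd.quadraticTwist (NumberField.discr K'' : ℚ)).entireLFunction 1 ≠ 0 ∧
          ∃ C : VariableChange ℚ, C • W'' = Wd.quadraticTwist (NumberField.discr K'' : ℚ) :=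
  Iff.rfl

/-- **Constructor from ambient instances** (the shape a per-pair display or a skeleton branch has in hand: the fields,
the two minimal models and the three readings as separate hypotheses). Bookkeeping. [folklore] -/
theorem twoStepAt_intro (p : ℕ) (W : WeierstrassCurve ℚ) [W.IsElliptic] [W.IsGloballyMinimal]
    (K : Type) [Field K] [NumberField K] (hK : IsImaginaryQuadratic K)
    (hHN : SatisfiesHeegnerHypothesis (W.conductorNorm ℤ) K) (hHp : SatisfiesHeegnerHypothesis p K)
    (hoddK : Odd (NumberField.discr K)) (hlt : NumberField.discr K < -4)
    (hr1 : (W.quadraticTwist (NumberField.discr K : ℚ)).analyticRank = 1)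
    (Wd : WeierstrassCurve ℚ) [Wd.IsElliptic] [Wd.IsGloballyMinimal]
    (hWd : ∃ C : VariableChange ℚ, C • Wd = W.quadraticTwist (NumberField.discr K : ℚ))
    (K'' : Type) [Field K''] [NumberField K''] (hK'' : IsImaginaryQuadratic K'')
    (hodd'' : Odd (NumberField.discr K'')) (hlt'' : NumberField.discr K'' < -4)
    (hHN'' : SatisfiesHeegnerHypothesis (Wd.conductorNorm ℤ) K'') (hHp'' : SatisfiesHeegnerHypothesis p K'')
    (hL'' : (Wd.quadraticTwist (NumberField.discr K'' : ℚ)).entireLFunction 1 ≠ 0)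
    (W'' : WeierstrassCurve ℚ) [W''.IsElliptic] [W''.IsGloballyMinimal]
    (hW'' : ∃ C : VariableChange ℚ, C • W'' = Wd.quadraticTwist (NumberField.discr K'' : ℚ)) :
    TwoStepAt p W W'' :=
  ⟨inferInstance, inferInstance, inferInstance, inferInstance, K, inferInstance, inferInstance, hK, hHN, hHp, hoddK, hlt,
    hr1, Wd, inferInstance, inferInstance, hWd, K'', inferInstance, inferInstance, hK'', hodd'', hlt'', hHN'', hHp'', hL'',
    hW''⟩

/-! ## §2. The far end is a model of an even twist unramified at `p`; X2b propagates along edges and chains -/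

/-- **Twists compose through models**: if `Wd` is a model of `W^{(d)}` (`C • Wd = W.quadraticTwist d`) and `W″` a
model of `Wd^{(d′)}`, then `W″` is a model of `W^{(d d′)}` — `quadraticTwist_smul` (twisting commutes with a change of
variables up to an explicit change of variables) and `quadraticTwist_quadraticTwist` (`(W^d)^{d′} = W^{d d′}` on the
nose). Silverman, AEC X.2 Prop. 2.4, X.5 Cor. 5.4.1. [folklore] -/
theorem exists_smul_eq_quadraticTwist_mul {W Wd W'' : WeierstrassCurve ℚ} {d d' : ℚ}
    {C C' : VariableChange ℚ} (hC : C • Wd = W.quadraticTwist d) (hC' : C' • W'' = Wd.quadraticTwist d') :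
    ∃ C₂ : VariableChange ℚ, C₂ • W'' = W.quadraticTwist (d * d') := by
  have hWd : Wd = C⁻¹ • W.quadraticTwist d := by rw [← hC, inv_smul_smul]
  have h2 : Wd.quadraticTwist d' =
      (⟨(C⁻¹).u, d' * (C⁻¹).r, 0, 0⟩ : VariableChange ℚ) • W.quadraticTwist (d * d') := by
    rw [hWd, quadraticTwist_smul, quadraticTwist_quadraticTwist]
  refine ⟨(⟨(C⁻¹).u, d' * (C⁻¹).r, 0, 0⟩ : VariableChange ℚ)⁻¹ * C', ?_⟩
  rw [mul_smul, hC', h2, inv_smul_smul]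

/-- **The far end of an edge is a model of an EVEN quadratic twist of `W` unramified at `p`**: `W″ ≅ E^{(D)}` with
`D = d_K · d_{K″} > 0` (both discriminants negative) and `p ∤ D` (`p` splits in `K` and in `K″`:
`not_dvd_discr_of_split`, `p` odd). Bookkeeping. [folklore] -/
theorem TwoStepAt.exists_smul_eq_quadraticTwist_pos {p : ℕ} [Fact p.Prime] {W W'' : WeierstrassCurve ℚ}
    (hp2 : p ≠ 2) (h : TwoStepAt p W W'') :
    ∃ (D : ℤ), 0 < D ∧ ¬ (p : ℤ) ∣ D ∧ ∃ C : VariableChange ℚ, C • W'' = W.quadraticTwist ((D : ℤ) : ℚ) := by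
  obtain ⟨_, _, _, _, K, _, _, hK, -, hHp, -, hlt, -, Wd, _, _, ⟨C, hC⟩, K'', _, _, hK'', -, hlt'', -, hHp'', -,
    ⟨C'', hC''⟩⟩ := h
  have hp : p.Prime := Fact.out
  refine ⟨NumberField.discr K * NumberField.discr K'', by nlinarith, ?_, ?_⟩
  · intro hdvd
    rcases (Nat.prime_iff_prime_int.mp hp).dvd_or_dvd hdvd with h1 | h1
    · exact not_dvd_discr_of_split hK hp hp2 hHp h1
    · exact not_dvd_discr_of_split hK'' hp hp2 hHp'' h1
  · obtain ⟨C₂, hC₂⟩ := exists_smul_eq_quadraticTwist_mul hC hC''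
    exact ⟨C₂, by rw [hC₂]; push_cast; rfl⟩

/-- **X2b propagates along an edge.** If `(W, p)` is a sub-cell X2b pair (`r_an = 0`, `p` odd, `E[p]` reducible,
`p ‖ N`, `¬GVPar`) and `TwoStepAt p W W″`, then `(W″, p)` is an X2b pair: `r_an(W″) = 0` from `L(W″, 1) =
L(Wd^{(d_{K″})}, 1) ≠ 0` (`entireLFunction_smul`, `analyticRank_eq_zero_iff_holds` — this is where modularity `hmod` is
used); class X2 by `X2.classX2_twist` at `(W, K)` and at `(Wd, K″)`; `¬GVPar W″ p` because an even twist unramified at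
`p` preserves the Greenberg–Vatsal type (`gvPar_twist_iff_of_pos`, Greenberg–Vatsal 2000, remark after Thm. (1.3)) and
`W″ ≅ E^{(d_K d_{K″})}`. Conditional on `hmod` only. [cite: GreenbergVatsal2000, remark after Thm. (1.3)] -/
theorem cellB_of_cellB_of_twoStepAt (hmod : WeierstrassCurve.hasEntireLFunction_rat)
    {p : ℕ} [Fact p.Prime] {W W'' : WeierstrassCurve ℚ} [W.IsElliptic] [W.IsGloballyMinimal]
    [W''.IsElliptic] [W''.IsGloballyMinimal] (hc : X2.CellB W p) (h : TwoStepAt p W W'') :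
    X2.CellB W'' p := by
  have hp2 : p ≠ 2 := hc.2.1.1
  obtain ⟨D, hD, hpD, C₂, hC₂⟩ := h.exists_smul_eq_quadraticTwist_pos hp2
  obtain ⟨_, _, _, _, K, _, _, hK, -, hHp, -, -, -, Wd, _, _, hWd, K'', _, _, hK'', -, -, -, hHp'', hL'',
    ⟨C'', hC''⟩⟩ := h
  have hXd : ClassX2 Wd p := X2.classX2_twist W p hc.2.1 K hK hHp Wd hWd
  have hX'' : ClassX2 W'' p := X2.classX2_twist Wd p hXd K'' hK'' hHp'' W'' ⟨C'', hC''⟩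
  have hL1 : W''.entireLFunction 1 ≠ 0 := by
    rw [← entireLFunction_smul W'' C'', hC'']; exact hL''
  have hr'' : W''.analyticRank = 0 := (W''.analyticRank_eq_zero_iff_holds (hmod W'')).2 hL1
  exact ⟨hr'', hX'', fun hgv ↦ hc.2.2 ((gvPar_twist_iff_of_pos hp2 hD hpD C₂ hC₂).1 hgv)⟩

/-- **X2b propagates along any finite chain of edges** (induction on `Relation.ReflTransGen`). Conditional on `hmod`
only. [folklore] -/
theorem cellB_of_cellB_of_reflTransGen_twoStepAt (hmod : WeierstrassCurve.hasEntireLFunction_rat)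
    {p : ℕ} [Fact p.Prime] {W W'' : WeierstrassCurve ℚ} [W.IsElliptic] [W.IsGloballyMinimal]
    [W''.IsElliptic] [W''.IsGloballyMinimal] (hc : X2.CellB W p)
    (h : Relation.ReflTransGen (TwoStepAt p) W W'') : X2.CellB W'' p := by
  have key : ∀ {b : WeierstrassCurve ℚ}, Relation.ReflTransGen (TwoStepAt p) W b →
      ∀ (_ : b.IsElliptic) (_ : b.IsGloballyMinimal), X2.CellB b p := by
    intro b hb
    induction hb with
    | refl => intro _ _; exact hc
    | @tail b c hab hbc ih =>
      intro _ _
      obtain ⟨_, _, _, _, -⟩ := id hbc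
      exact cellB_of_cellB_of_twoStepAt hmod (ih inferInstance inferInstance) hbc
  exact key h inferInstance inferInstance

/-! ## §3. The registered v7 stub's excluded datum is a unit end ONE edge away -/

/-- **The two-step Ш-unit datum of `stub_upperPartnerOffSubrowNoUnitEnd` (twistback v7) is a unit end reachable by ONE
edge**: from the datum (VERBATIM the hypothesis `he` of the skeleton's `upperPartner_ofUnitEnd` / the second negated
hypothesis of the registered stub) one gets `W″` with `Relation.TransGen (TwoStepAt p) W W″` (a single edge,
`Relation.TransGen.single ∘ twoStepAt_intro`) and `#Ш_an(W″)` a rational `p`-unit. So «no unit end reachable at any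
distance `≥ 1`» is a WEAKER open statement than the registered one; the companion chain file derives the stub's
conclusion on the difference. Bookkeeping; nothing asserted. [folklore] -/
theorem exists_transGen_twoStepAt_shaAn_unit_of_twoStepShaUnitDatum {p : ℕ} {W : WeierstrassCurve ℚ}
    [W.IsElliptic] [W.IsGloballyMinimal]
    (he : ∃ (K : Type) (_ : Field K) (_ : NumberField K), IsImaginaryQuadratic K ∧
      SatisfiesHeegnerHypothesis (W.conductorNorm ℤ) K ∧ SatisfiesHeegnerHypothesis p K ∧
      Odd (NumberField.discr K) ∧ NumberField.discr K < -4 ∧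
      (W.quadraticTwist (NumberField.discr K : ℚ)).analyticRank = 1 ∧
      ∃ (Wd : WeierstrassCurve ℚ) (_ : Wd.IsElliptic) (_ : Wd.IsGloballyMinimal),
        (∃ C : VariableChange ℚ, C • Wd = W.quadraticTwist (NumberField.discr K : ℚ)) ∧
        ∃ (K'' : Type) (_ : Field K'') (_ : NumberField K''), IsImaginaryQuadratic K'' ∧
          Odd (NumberField.discr K'') ∧ NumberField.discr K'' < -4 ∧
          SatisfiesHeegnerHypothesis (Wd.conductorNorm ℤ) K'' ∧ SatisfiesHeegnerHypothesis p K'' ∧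
          (Wd.quadraticTwist (NumberField.discr K'' : ℚ)).entireLFunction 1 ≠ 0 ∧
          ∃ (W'' : WeierstrassCurve ℚ) (_ : W''.IsElliptic) (_ : W''.IsGloballyMinimal),
            (∃ C : VariableChange ℚ, C • W'' = Wd.quadraticTwist (NumberField.discr K'' : ℚ)) ∧
            ∃ q : ℚ, shaAn W'' = (q : ℂ) ∧ padicValRat p q = 0) :
    ∃ (W'' : WeierstrassCurve ℚ) (_ : W''.IsElliptic) (_ : W''.IsGloballyMinimal),
      Relation.TransGen (TwoStepAt p) W W'' ∧ ∃ q : ℚ, shaAn W'' = (q : ℂ) ∧ padicValRat p q = 0 := by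
  obtain ⟨K, _, _, hK, hHN, hHp, hoddK, hlt, hr1, Wd, _, _, hWd, K'', _, _, hK'', hodd'', hlt'', hHN'', hHp'', hL'',
    W'', _, _, hW'', hunit⟩ := he
  exact ⟨W'', inferInstance, inferInstance, Relation.TransGen.single (twoStepAt_intro p W K hK hHN hHp hoddK hlt hr1
    Wd hWd K'' hK'' hodd'' hlt'' hHN'' hHp'' hL'' W'' hW''), hunit⟩

/-- Conversely-shaped bookkeeping for the distance-zero case: an X2b pair that is ITSELF a unit end reaches a unit end
by the empty chain (`Relation.ReflTransGen.refl`). (There Wuthrich 2014 Prop. 21 already gives the main conjecture: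
`X2.mazurMainConjectureAt_of_cellB_of_shaAn_unit`.) [folklore] -/
theorem exists_reflTransGen_twoStepAt_shaAn_unit_of_shaAn_unit {p : ℕ} {W : WeierstrassCurve ℚ}
    [W.IsElliptic] [W.IsGloballyMinimal] (hunit : ∃ q : ℚ, shaAn W = (q : ℂ) ∧ padicValRat p q = 0) :
    ∃ (W'' : WeierstrassCurve ℚ) (_ : W''.IsElliptic) (_ : W''.IsGloballyMinimal),
      Relation.ReflTransGen (TwoStepAt p) W W'' ∧ ∃ q : ℚ, shaAn W'' = (q : ℂ) ∧ padicValRat p q = 0 :=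
  ⟨W, inferInstance, inferInstance, Relation.ReflTransGen.refl, hunit⟩

end Summit.BirchSwinnertonDyer.BirchSwinnertonDyer.Theorems.EisensteinPrimesMazurMCOnCellBTwistbackTwoStepDefs

end
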